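import Summits.CriticalPhenomena.SAWScalingLimit.Theorems.SAWLoopFugacityFlowSimpleSubseqLimitsFirstHitPassage
import Summits.CriticalPhenomena.SAWScalingLimit.Theorems.SAWLoopFugacityFlowSimpleSubseqLimitsFirstHitFlatGuard
import HarnessLib

/-!
# The ORDER input as FIRST-ENTRANCE SLIT AVOIDANCE: far first-hit returns, limit passage and closing
(crux stmt-CriticalPhenomena-4982, decl `Summit.CriticalPhenomena.SAWScalingLimit.Theses.SAWLoopFugacityFlow.SimpleSubseqLimits`;
line `past-shadowing-costs-halves`, reshaping v4; line lead c4, 2026-08-17)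

The first-hit typing `FirstHit.Passage.FirstHitDecayAt` (lead c2, p129883) charges the thickened event
"`γ` is `r`-far from `q` on `[0, v]`, `r'`-close to `q` at `T > v`, `γ v` is `ρ`-far from `γ T`, and
`γ t'`, `t' ≥ T`, is `ε`-close to `γ v`".  Its docstring describes the lattice mechanism as the exact
domain Markov property at the first entrance into the ball — but the typed event does NOT enforce it:
`v` may come AFTER the first entrance of the walk into `B(q, r')` (the curve may enter, leave, wander,
and only then produce `v`, `T`, `t'`), so the event mixes genuine past/future interactions with
future/future near-returns of the conditioned walk, which no slit-domain statement controls.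

This file types the ORDER input so that the mechanism IS enforced, using the guarded closing lemma
`FirstHitFlatGuard` (this seat): only returns to the FAR past need excluding.
* `FarReturn γ q r` (exact): `v < T ≤ t'`, `T` the first hit of `B̄(q, r)`, the initial piece
  `γ [0, v]` OUTSIDE the guard ball (`5r < dist (γ u) q`, `u ≤ v`), and `γ t' = γ v`;
* `NearFarReturn γ q r₀ r r' ε` (open thickening, `r₀ < r < r'`): `v < T ≤ t'`, `γ [0, v]` outside the
  guard ball, `γ [0, T]` outside `B̄(q, r₀)`, `γ T ∈ B(q, r')`, `dist (γ t') (γ v) < ε`;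
* `FarReturnDecayAt D a b`: `∀ q r θ, ∃ ε r₀ r'` (`0 < r₀ < r < r'`) with
  `P_δ[NearFarReturn] ≤ θ` eventually as `δ → 0⁺`; `FarReturnDecay`: along every `IsEndpointApprox`.
THE POINT (`nearFarReturn_pastFuture`): whenever `r' ≤ 5r`, a thickened far return is a ONE-STOPPING-TIME
PAST/FUTURE event — with `τ` the first hit of `B̄(q, r')` one has `v < τ ≤ t'`, and the future after `τ`
comes `ε`-close to the past value `γ v`, which is `(5r - r')`-far from the entrance point `γ τ`. On the
lattice, by the exact domain Markov property at the first vertex in `B̄(q, r')`, this is the event that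
the critical SAW of the SLIT graph `Ω_δ ∖ γ[0, τ)`, started at the tip, approaches the far part of the
slit: LSW's "the rest of the walk avoids its past as it avoids the boundary" (LSW04 §3.4.5) as a
precise lattice statement, the natural companion of `Boundary.Passage.BoundaryDecay` (avoid `∂Ω`).

Results (namespace `…Theorems.SimpleSubseqLimits.FarPast.Passage`): `le_dist_of_firstHit`,
`nearFarReturn_of_farReturn`, `farReturnEvent_subset_near` (exact ⊆ thickened),
`isOpen_setOf_nearFarReturn` / `isOpen_nearFarReturnEvent` (openness), `nearFarReturn_pastFuture`
(the one-stopping-time form), `nearFarReturn_nearFirstHitReturn` (a far return is a first-hit return of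
c2's typing with `ρ = 3r` when `r' ≤ 2r` — so the new input is implied by the old), `farReturn_null`
(limit passage, open-set portmanteau), `mem_simple_of_forall_notMem_farReturnEvent` (closing by
`FirstHitFlatGuard`), `ae_simple_of_farReturnDecayAt` (every subsequential weak limit with far-return
decay is carried by SIMPLE classes), `stub_farReturnPassage` (registered form).
-/

noncomputable section

open MeasureTheory Filter Topology Set Metric Function
open Literature.Probability.RandomPlanarGeometry Literature.Probability.LatticeModels
open scoped ENNReal NNReal BoundedContinuousFunction unitInterval

namespace Summit.CriticalPhenomena.SAWScalingLimit.Theorems.SimpleSubseqLimits.FarPast.Passage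

open Summit.CriticalPhenomena.SAWScalingLimit.Theorems.SimpleSubseqLimits.Negative
  (WeakLimitAlong ae_source_target_range_of_weakLimitAlong)
open Summit.CriticalPhenomena.SAWScalingLimit.Theorems.SimpleSubseqLimits.MarkedPointRevisit.Passage
  (latticeCurve mk_mem_image_mk_iff measure_image_mk_le_limsup_law IsSubseqLimit)
open Summit.CriticalPhenomena.SAWScalingLimit.Theorems.SimpleSubseqLimits.FirstHitFlat (exists_firstHit)
open Summit.CriticalPhenomena.SAWScalingLimit.Theorems.SimpleSubseqLimits.FirstHitFlatGuard
  (mk_mem_simple_of_firstHit_closedBall)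
open Summit.CriticalPhenomena.SAWScalingLimit.Theorems.SimpleSubseqLimits.FirstHit.Passage
  (NearFirstHitReturn gaussRat countable_gaussRat dense_gaussRat)

/-! ### Vocabulary -/

/-- **Exact far first-hit return** of a curve at the closed ball `B̄(q, r)`: times `v < T ≤ t'` with
`T` the FIRST hitting time of `B̄(q, r)`, the initial piece `γ [0, v]` outside the guard ball
`B̄(q, 5r)`, and an exact return `γ t' = γ v`. A flat curve has none; by the guarded Rohde–Schramm lemma
a non-flat curve has one for suitable rational data. [folklore] -/
def FarReturn (γ : Curve ℂ) (q : ℂ) (r : ℝ) : Prop :=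
  ∃ v T t' : I, v < T ∧ T ≤ t' ∧ γ T ∈ closedBall q r ∧ (∀ u : I, u < T → γ u ∉ closedBall q r) ∧
    (∀ u : I, u ≤ v → 5 * r < dist (γ u) q) ∧ γ t' = γ v

/-- The event "some representative has an exact far first-hit return at `(q, r)`". [folklore] -/
def farReturnEvent (q : ℂ) (r : ℝ) : Set (CurveClass ℂ) :=
  {c | ∃ γ : Curve ℂ, CurveClass.mk γ = c ∧ FarReturn γ q r}

/-- **Thickened (open) far first-hit return** (`r₀ < r < r'`): times `v < T ≤ t'` with `γ [0, v]`
outside the guard ball `B̄(q, 5r)`, `γ [0, T]` outside `B̄(q, r₀)`, `γ T ∈ B(q, r')` — so `T` is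
squeezed between the first entrances into `B̄(q, r')` and `B̄(q, r₀)` — and `γ t'` `ε`-close to `γ v`.
All inequalities strict, the universal clauses over the compact `[0, v]`, `[0, T]`: an OPEN,
reparametrisation-invariant condition, visible on the lattice polyline. [folklore] -/
def NearFarReturn (γ : Curve ℂ) (q : ℂ) (r₀ r r' ε : ℝ) : Prop :=
  ∃ v T t' : I, v < T ∧ T ≤ t' ∧ (∀ u : I, u ≤ v → 5 * r < dist (γ u) q) ∧
    (∀ u : I, u ≤ T → r₀ < dist (γ u) q) ∧ dist (γ T) q < r' ∧ dist (γ t') (γ v) < ε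

/-- The event "some representative has a thickened far first-hit return at `(q, r₀, r, r', ε)`".
[folklore] -/
def nearFarReturnEvent (q : ℂ) (r₀ r r' ε : ℝ) : Set (CurveClass ℂ) :=
  {c | ∃ γ : Curve ℂ, CurveClass.mk γ = c ∧ NearFarReturn γ q r₀ r r' ε}

/-- **Far-return decay at `(D; a_δ, b_δ)`** — the ORDER input of the crux typed as FIRST-ENTRANCE SLIT
AVOIDANCE: for every centre `q`, radius `r > 0` and target `θ > 0` there are a width `ε > 0` and radii
`0 < r₀ < r < r'` such that for all small meshes the critical SAW law charges the thickened far-return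
event at most `θ`. (The prover of the input may take `r₀`, `r'` as close to `r` as convenient: the event
grows with `r'` and shrinks with `r₀`; with `r' ≤ 5r` the event is a past/future interaction at the
first entrance into `B̄(q, r')`, `nearFarReturn_pastFuture`.) An open statement of this crux — implied
by `FirstHit.Passage.FirstHitDecayAt`, hence by the summit conjecture, and necessary for the crux given
`EventualTight`; deliberately untagged: it is not a literature fact. -/
def FarReturnDecayAt (D : DobrushinDomain) (a b : ℝ → Site 2) : Prop :=
  ∀ (q : ℂ) (r θ : ℝ), 0 < r → 0 < θ → ∃ ε r₀ r' : ℝ, 0 < ε ∧ 0 < r₀ ∧ r₀ < r ∧ r < r' ∧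
    ∀ᶠ δ in 𝓝[>] (0 : ℝ),
      SAW.law D.carrier δ (a δ) (b δ) {γ | γ.curve ∈ nearFarReturnEvent q r₀ r r' ε} ≤
        ENNReal.ofReal θ

/-- Far-return decay along EVERY endpoint approximation (the first-entrance slit-avoidance typing of
the crux's ORDER input; open, untagged). -/
def FarReturnDecay : Prop :=
  ∀ (D : DobrushinDomain) (a b : ℝ → Site 2), SAW.IsEndpointApprox D a b → FarReturnDecayAt D a b

/-! ### Step 1: exact far returns are thickened far returns -/

/-- At a first hitting time `T` of the closed ball `B̄(q, r)` preceded by some time `v < T`, the curve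
is at distance `≥ r` from `q`: `T` lies in the closure of `[0, T)` (`[0, 1]` is densely ordered), on
which the distance exceeds `r`. [folklore] -/
theorem le_dist_of_firstHit {γ : Curve ℂ} {q : ℂ} {r : ℝ} {v T : I} (hvT : v < T)
    (hfirst : ∀ u : I, u < T → γ u ∉ closedBall q r) : r ≤ dist (γ T) q := by
  have hcont : Continuous fun u : I => dist (γ u) q := γ.continuous.dist continuous_const
  have hmem : T ∈ closure (Iio T) := by
    rw [closure_Iio' ⟨v, hvT⟩]
    exact self_mem_Iic
  have himg := (hcont.continuousWithinAt (s := Iio T) (x := T)).mem_closure_image hmem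
  have hsub : (fun u : I => dist (γ u) q) '' Iio T ⊆ Ici r := by
    rintro _ ⟨u, hu, rfl⟩
    have h := hfirst u hu
    rw [mem_closedBall, not_le] at h
    exact h.le
  have h := closure_mono hsub himg
  rwa [closure_Ici] at h

/-- An exact far return at `(q, r)` is a thickened one at `(q, r₀, r, r', ε)` for all `r₀ < r < r'`,
`ε > 0` (same witnessing times). [folklore] -/
theorem nearFarReturn_of_farReturn {γ : Curve ℂ} {q : ℂ} {r₀ r r' ε : ℝ} (hr₀ : r₀ < r)
    (hr' : r < r') (hε : 0 < ε) (h : FarReturn γ q r) : NearFarReturn γ q r₀ r r' ε := by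
  obtain ⟨v, T, t', hvT, hTt, hT, hfirst, hguard, hret⟩ := h
  refine ⟨v, T, t', hvT, hTt, hguard, fun u hu => ?_, ?_, ?_⟩
  · rcases hu.lt_or_eq with hlt | rfl
    · have h := hfirst u hlt
      rw [mem_closedBall, not_le] at h
      exact hr₀.trans h
    · exact hr₀.trans_le (le_dist_of_firstHit hvT hfirst)
  · rw [mem_closedBall] at hT
    exact hT.trans_lt hr'
  · rw [hret, dist_self]
    exact hε

/-- `farReturnEvent q r ⊆ nearFarReturnEvent q r₀ r r' ε` for `r₀ < r < r'`, `0 < ε`. [folklore] -/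
theorem farReturnEvent_subset_near {q : ℂ} {r₀ r r' ε : ℝ} (hr₀ : r₀ < r) (hr' : r < r')
    (hε : 0 < ε) : farReturnEvent q r ⊆ nearFarReturnEvent q r₀ r r' ε :=
  fun _ ⟨γ, hγ, h⟩ => ⟨γ, hγ, nearFarReturn_of_farReturn hr₀ hr' hε h⟩

/-! ### Step 2: the thickened configuration is open -/

/-- Uniform slack of a strict lower bound for `dist (γ ·) q` on a compact initial piece `[0, w]`.
[folklore] -/
theorem exists_slack_Iic (γ : Curve ℂ) (q : ℂ) {c : ℝ} {w : I}
    (h : ∀ u : I, u ≤ w → c < dist (γ u) q) :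
    ∃ m : ℝ, c < m ∧ ∀ u : I, u ≤ w → m ≤ dist (γ u) q := by
  have hK : IsCompact (Iic w) := isClosed_Iic.isCompact
  have hc : ContinuousOn (fun u : I => dist (γ u) q) (Iic w) :=
    (γ.continuous.dist continuous_const).continuousOn
  obtain ⟨u₀, hu₀, hmin⟩ := hK.exists_isMinOn nonempty_Iic hc
  exact ⟨dist (γ u₀) q, h u₀ hu₀, fun u hu => hmin hu⟩

/-- **Openness of the thickened far-return configuration** for the reparametrisation pseudo-distance on
`Curve ℂ`: fix witnessing times `v < T ≤ t'`; the two universal clauses have uniform slacks on the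
compact `[0, v]`, `[0, T]`, the two pointwise clauses positive slacks; a curve at distance below half
the least slack has a reparametrisation uniformly that close (`Curve.exists_dist_reparam_lt`), which
transports the witnesses. [folklore] -/
theorem isOpen_setOf_nearFarReturn (q : ℂ) (r₀ r r' ε : ℝ) :
    IsOpen {γ : Curve ℂ | NearFarReturn γ q r₀ r r' ε} := by
  rw [Metric.isOpen_iff]
  rintro γ ⟨v, T, t', hvT, hTt, hguard, hpast, hT, hret⟩
  obtain ⟨m₁, hm₁, hmin₁⟩ := exists_slack_Iic γ q hguard
  obtain ⟨m₂, hm₂, hmin₂⟩ := exists_slack_Iic γ q hpast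
  obtain ⟨d, hd0, hd1, hd2, hd3, hd4⟩ : ∃ d : ℝ, 0 < d ∧ 2 * d ≤ m₁ - 5 * r ∧ 2 * d ≤ m₂ - r₀ ∧
      2 * d ≤ r' - dist (γ T) q ∧ 2 * d ≤ ε - dist (γ t') (γ v) := by
    refine ⟨min (min (m₁ - 5 * r) (m₂ - r₀)) (min (r' - dist (γ T) q) (ε - dist (γ t') (γ v))) / 2,
      half_pos (lt_min (lt_min (sub_pos.2 hm₁) (sub_pos.2 hm₂)) (lt_min (sub_pos.2 hT) (sub_pos.2 hret))),
      ?_, ?_, ?_, ?_⟩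
    · linarith [min_le_left (min (m₁ - 5 * r) (m₂ - r₀)) (min (r' - dist (γ T) q) (ε - dist (γ t') (γ v))),
        min_le_left (m₁ - 5 * r) (m₂ - r₀)]
    · linarith [min_le_left (min (m₁ - 5 * r) (m₂ - r₀)) (min (r' - dist (γ T) q) (ε - dist (γ t') (γ v))),
        min_le_right (m₁ - 5 * r) (m₂ - r₀)]
    · linarith [min_le_right (min (m₁ - 5 * r) (m₂ - r₀)) (min (r' - dist (γ T) q) (ε - dist (γ t') (γ v))),
        min_le_left (r' - dist (γ T) q) (ε - dist (γ t') (γ v))]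
    · linarith [min_le_right (min (m₁ - 5 * r) (m₂ - r₀)) (min (r' - dist (γ T) q) (ε - dist (γ t') (γ v))),
        min_le_right (r' - dist (γ T) q) (ε - dist (γ t') (γ v))]
  refine ⟨d, hd0, fun γ' hγ' => ?_⟩
  rw [Metric.mem_ball, dist_comm] at hγ'
  obtain ⟨φ, hφ⟩ := Curve.exists_dist_reparam_lt hγ'
  have hcl : ∀ u, dist (γ u) (γ' (φ u)) < d := fun u => by
    have h := ContinuousMap.dist_apply_le_dist (f := γ.toContinuousMap)
      (g := (γ'.reparam φ).toContinuousMap) (x := u)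
    simp only [Curve.coe_toContinuousMap, Curve.reparam_apply] at h
    exact h.trans_lt hφ
  have hcl' : ∀ u', dist (γ (φ.symm u')) (γ' u') < d := fun u' => by
    simpa only [OrderIso.apply_symm_apply] using hcl (φ.symm u')
  refine ⟨φ v, φ T, φ t', φ.lt_iff_lt.2 hvT, φ.le_iff_le.2 hTt, ?_, ?_, ?_, ?_⟩
  · intro u' hu'
    have hle : φ.symm u' ≤ v := φ.symm_apply_le.2 hu'
    have h₁ := hmin₁ (φ.symm u') hle
    have h₂ := dist_triangle (γ (φ.symm u')) (γ' u') q
    have h₃ := hcl' u'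
    linarith
  · intro u' hu'
    have hle : φ.symm u' ≤ T := φ.symm_apply_le.2 hu'
    have h₁ := hmin₂ (φ.symm u') hle
    have h₂ := dist_triangle (γ (φ.symm u')) (γ' u') q
    have h₃ := hcl' u'
    linarith
  · have h₁ := dist_triangle (γ' (φ T)) (γ T) q
    have h₂ := hcl T
    rw [dist_comm] at h₂
    linarith
  · have h₁ := dist_triangle (γ' (φ t')) (γ t') (γ' (φ v))
    have h₂ := dist_triangle (γ t') (γ v) (γ' (φ v))
    have h₃ := hcl t'
    have h₄ := hcl v
    rw [dist_comm] at h₃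
    linarith

/-- The thickened event is the image of the open configuration set under the quotient map.
[folklore] -/
theorem nearFarReturnEvent_eq_image (q : ℂ) (r₀ r r' ε : ℝ) :
    nearFarReturnEvent q r₀ r r' ε = CurveClass.mk '' {γ | NearFarReturn γ q r₀ r r' ε} :=
  Set.ext fun _ => exists_congr fun _ => and_comm

/-- **The thickened far-return event is open** in `CurveClass ℂ` (`SeparationQuotient.mk` is an open
map). [folklore] -/
theorem isOpen_nearFarReturnEvent (q : ℂ) (r₀ r r' ε : ℝ) :
    IsOpen (nearFarReturnEvent q r₀ r r' ε) := by
  rw [nearFarReturnEvent_eq_image]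
  exact SeparationQuotient.isOpenMap_mk _ (isOpen_setOf_nearFarReturn q r₀ r r' ε)

/-- The lattice event `{γ | γ.curve ∈ nearFarReturnEvent …}` is the polyline event
`{γ | NearFarReturn (latticeCurve γ) …}` (open sets of curves are saturated for distance zero).
[folklore] -/
theorem setOf_nearFarReturn_latticeCurve {Ω : Set ℂ} {δ : ℝ} {u v : Site 2} (q : ℂ)
    (r₀ r r' ε : ℝ) :
    {γ : SAW.DomainSAW Ω δ u v | NearFarReturn (latticeCurve γ) q r₀ r r' ε} =
      {γ | γ.curve ∈ nearFarReturnEvent q r₀ r r' ε} := by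
  ext γ
  simp only [mem_setOf_eq, nearFarReturnEvent_eq_image]
  exact (mk_mem_image_mk_iff (isOpen_setOf_nearFarReturn q r₀ r r' ε) (latticeCurve γ)).symm

/-! ### Step 3: the one-stopping-time form and the comparison with the first-hit typing -/

/-- **A thickened far return is a PAST/FUTURE event at ONE stopping time.** If `r' ≤ 5r` and `γ` has a
thickened far return at `(q, r₀, r, r', ε)`, then with `τ` the FIRST hitting time of the closed ball
`B̄(q, r')`: the witness `v` precedes `τ` (the initial piece `γ [0, v]` lies outside the guard ball,
which contains `B̄(q, r')`), the return time `t'` follows `τ`, the past value `γ v` is `(5r - r')`-far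
from the entrance point `γ τ`, and `γ t'` is `ε`-close to `γ v`. On the lattice (exact domain Markov
property at the first vertex in `B̄(q, r')`) this is the event that the conditioned future — the
critical SAW of the slit graph from the tip — comes `ε`-close to the far part of the slit. [folklore] -/
theorem nearFarReturn_pastFuture {γ : Curve ℂ} {q : ℂ} {r₀ r r' ε : ℝ} (h5 : r' ≤ 5 * r)
    (h : NearFarReturn γ q r₀ r r' ε) :
    ∃ v τ t' : I, v < τ ∧ τ ≤ t' ∧ γ τ ∈ closedBall q r' ∧ (∀ u : I, u < τ → γ u ∉ closedBall q r') ∧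
      (∀ u : I, u ≤ v → 5 * r < dist (γ u) q) ∧ 5 * r - r' < dist (γ v) (γ τ) ∧
        dist (γ t') (γ v) < ε := by
  obtain ⟨v, T, t', hvT, hTt, hguard, -, hT, hret⟩ := h
  have hTmem : γ T ∈ closedBall q r' := by
    rw [mem_closedBall]
    exact hT.le
  obtain ⟨τ, hτT, hτ, hfirst⟩ := exists_firstHit γ isClosed_closedBall hTmem
  have hvτ : v < τ := by
    refine lt_of_not_ge fun hτv => ?_
    have h := hguard τ hτv
    rw [mem_closedBall] at hτ
    linarith
  refine ⟨v, τ, t', hvτ, hτT.trans hTt, hτ, hfirst, hguard, ?_, hret⟩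
  have h₁ := hguard v le_rfl
  have h₂ := dist_triangle (γ v) (γ τ) q
  rw [mem_closedBall] at hτ
  linarith

/-- **A thickened far return is a thickened first-hit return of the earlier typing** (c2's
`FirstHit.Passage.NearFirstHitReturn`) with separation `ρ = 3r`, as soon as `r' ≤ 2r` and `r' ≤ R'`:
the guard clause gives `r`-farness on `[0, v]` and the separation `dist (γ v) (γ T) > 5r - r' ≥ 3r`.
So the far-return input is IMPLIED by the first-hit input. [folklore] -/
theorem nearFarReturn_nearFirstHitReturn {γ : Curve ℂ} {q : ℂ} {r₀ r r' R' ε : ℝ} (hr : 0 ≤ r)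
    (h2 : r' ≤ 2 * r) (hR : r' ≤ R') (h : NearFarReturn γ q r₀ r r' ε) :
    NearFirstHitReturn γ q r R' (3 * r) ε := by
  obtain ⟨v, T, t', hvT, hTt, hguard, -, hT, hret⟩ := h
  refine ⟨v, T, t', hvT, hTt, fun u hu => ?_, hT.trans_le hR, ?_, hret⟩
  · have h := hguard u hu
    linarith
  · have h₁ := hguard v le_rfl
    have h₂ := dist_triangle (γ v) (γ T) q
    linarith

/-! ### Step 4: the limit passage -/

/-- **LIMIT PASSAGE.** Far-return decay at `(D; a_δ, b_δ)` + weak convergence of the critical SAW laws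
along `s n → 0⁺` to `ν` ⇒ `ν` gives mass `0` to every exact far-return event (`0 < r`): the exact event
lies in the thickened one, the image of an OPEN set of curves, so the open-set portmanteau bound
`ν(G) ≤ limsup_{δ → 0⁺} P_δ(G)` (`Passage.measure_image_mk_le_limsup_law`) and the decay give
`ν (farReturnEvent q r) ≤ θ` for every `θ > 0`. [cite: BillingsleyCPM1999, Thm. 2.1] -/
theorem farReturn_null {D : DobrushinDomain} {a b : ℝ → Site 2} {s : ℕ → ℝ}
    {ν : Measure (CurveClass ℂ)} (hFD : FarReturnDecayAt D a b) (hL : IsSubseqLimit D a b s ν)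
    (q : ℂ) {r : ℝ} (hr : 0 < r) : ν (farReturnEvent q r) = 0 := by
  obtain ⟨hs, hν, hw⟩ := hL
  haveI := hν
  have hθ : ∀ θ : ℝ, 0 < θ → ν (farReturnEvent q r) ≤ ENNReal.ofReal θ := by
    intro θ hθ
    obtain ⟨ε, r₀, r', hε, -, hr₀, hr', hev⟩ := hFD q r θ hr hθ
    calc ν (farReturnEvent q r)
        ≤ ν (nearFarReturnEvent q r₀ r r' ε) := measure_mono (farReturnEvent_subset_near hr₀ hr' hε)
      _ = ν (CurveClass.mk '' {γ | NearFarReturn γ q r₀ r r' ε}) := by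
          rw [nearFarReturnEvent_eq_image]
      _ ≤ limsup (fun δ : ℝ => SAW.law D.carrier δ (a δ) (b δ)
            {γ | NearFarReturn (latticeCurve γ) q r₀ r r' ε}) (𝓝[>] (0 : ℝ)) :=
          measure_image_mk_le_limsup_law hs hw (isOpen_setOf_nearFarReturn _ _ _ _ _)
      _ ≤ ENNReal.ofReal θ := by
          refine limsup_le_of_le (by isBoundedDefault) (hev.mono fun δ hδ => ?_)
          rwa [setOf_nearFarReturn_latticeCurve]
  refine le_antisymm (ENNReal.le_of_forall_pos_le_add fun θ hθ' _ => ?_) zero_le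
  rw [zero_add, ← ENNReal.ofReal_coe_nnreal]
  exact hθ θ (NNReal.coe_pos.2 hθ')

/-! ### Step 5: the deterministic closing (guarded Rohde–Schramm, `FirstHitFlatGuard`) -/

/-- **CLOSING.** A class with distinct endpoints lying outside every exact far-return event with
Gaussian-rational centre and positive rational radius is SIMPLE: any representative then has no return,
after the first hit of any such closed ball, to a value taken while it was outside the guard ball, so the
guarded closing lemma `FirstHitFlatGuard.mk_mem_simple_of_firstHit_closedBall` applies. No SHAPE input.
[cite: RohdeSchramm2005, Thm. 6.1] -/
theorem mem_simple_of_forall_notMem_farReturnEvent (c : CurveClass ℂ)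
    (h : ∀ q ∈ gaussRat, ∀ r : ℚ, 0 < r → c ∉ farReturnEvent q r)
    (h01 : c.source ≠ c.target) : c ∈ CurveClass.simple := by
  obtain ⟨γ, rfl⟩ := CurveClass.surjective_mk c
  refine mk_mem_simple_of_firstHit_closedBall γ dense_gaussRat ?_ h01
  intro q hq r hr T hT hfirst v u hvT hTu hguard heq
  exact h q hq r hr ⟨γ, rfl, v, T, u, hvT, hTu, hT, hfirst, hguard, heq⟩

/-- **Every subsequential weak limit with far-return decay is carried by SIMPLE classes** (the ORDER
half of the crux from the first-entrance slit-avoidance input alone): the countably many exact events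
are `ν`-null (`farReturn_null`), the endpoints `a ≠ b` are free
(`Negative.ae_source_target_range_of_weakLimitAlong`, `MarkedDomain.pt_injective`), and the closing
lemma applies `ν`-a.e. [folklore] -/
theorem ae_simple_of_farReturnDecayAt {D : DobrushinDomain} {a b : ℝ → Site 2} {s : ℕ → ℝ}
    {ν : Measure (CurveClass ℂ)} (hab : SAW.IsEndpointApprox D a b) (hFD : FarReturnDecayAt D a b)
    (hL : IsSubseqLimit D a b s ν) : ∀ᵐ c ∂ν, c ∈ CurveClass.simple := by
  haveI := hL.2.1
  have hfree := ae_source_target_range_of_weakLimitAlong (ν := ν) hab hL.1 hL.2.2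
  haveI : Countable gaussRat := countable_gaussRat.to_subtype
  have hnull : ∀ᵐ c ∂ν, ∀ q : gaussRat, ∀ r : {x : ℚ // 0 < x},
      c ∉ farReturnEvent (q : ℂ) (r : ℚ) := by
    rw [ae_all_iff]; intro q
    rw [ae_all_iff]; intro r
    have hr : (0 : ℝ) < ((r : ℚ) : ℝ) := by exact_mod_cast r.2
    exact measure_eq_zero_iff_ae_notMem.1 (farReturn_null hFD hL q hr)
  filter_upwards [hfree, hnull] with c hc hn
  refine mem_simple_of_forall_notMem_farReturnEvent c (fun q hq r hr => ?_) ?_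
  · exact hn ⟨q, hq⟩ ⟨r, hr⟩
  · rw [hc.1, hc.2.1]
    exact fun h => absurd (D.pt_injective h) (by decide)

/-- **Registered form (stub `stub_farReturnPassage` of the crux item stmt-CriticalPhenomena-4982).**
Along every endpoint approximation, far-return decay at `(D; a_δ, b_δ)` forces every subsequential weak
limit of the critical SAW laws to be carried by SIMPLE classes — the ORDER half of the crux from the
first-entrance slit-avoidance input alone (no SHAPE input). [folklore] -/
theorem stub_farReturnPassage : ∀ (D : DobrushinDomain) (a b : ℝ → Site 2) (s : ℕ → ℝ) (ν : Measure (CurveClass ℂ)), SAW.IsEndpointApprox D a b → FarReturnDecayAt D a b → IsSubseqLimit D a b s ν → ∀ᵐ c ∂ν, c ∈ CurveClass.simple :=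
  fun _D _a _b _s _ν hab hFD hL => ae_simple_of_farReturnDecayAt hab hFD hL

end Summit.CriticalPhenomena.SAWScalingLimit.Theorems.SimpleSubseqLimits.FarPast.Passage

end
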